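import Literature.MathematicalPhysics.QuantumFieldTheory.Balaban1983to89.B1Eq31Concrete
import Literature.MathematicalPhysics.QuantumFieldTheory.Balaban1983to89.B1Ineq351Proof
import Literature.MathematicalPhysics.QuantumFieldTheory.Balaban1983to89.B1Sect3FormsConcrete

/-!
# Bałaban, *(Higgs)₂,₃ quantum fields in a finite volume I*, CMP **85** (1982): the fluctuation-field characteristic
# functions `χ(A′)` (3.12)/(3.43) and `χ(φ′)` (3.20)/(3.50) WITH BODY on the (Higgs)₂,₃ carrier, and their printed use

statement-level skeleton of published theorems with citation tags; proofs where landed; nothing here is a claim about the Yang–Mills mass gap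

CITATION HEADER.  T. Bałaban, *(Higgs)₂,₃ quantum fields in a finite volume. I. A lower bound*, Commun. Math. Phys. **85**
(1982) 603–626 [Balaban1982Higgs1] (cell paper B1; PDF held `paper:balaban1982-cmp85-higgs23-i`, journal page = PDF page +
602; pp. 614, 615, 619, 621 read AS IMAGES on the ×2 renders `run/shared/lean/pub/pub-balaban/b2b-balaban-ref1/pages/
1982-cmp85-higgs23-I/1982-cmp85-higgs23-I-p012/p013/p017/p019-x2.png`).  Unit `lit-balaban-r14` gen 23
(literature-prover-lit-balaban-r14-g23-0; B1 fold owner; HOME `run/shared/lean/pub/lit-balaban/`).  SKELETON rows served: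
r12's finer rows **B1.Eq3.12**, **B1.Eq3.43**, **B1.Eq3.50** (decl of record: r12's restriction `B1Sect3Statements.SmallFluct`,
a `Prop`; `typed`) and the (3.20) part of **B1.Eq3.20-3.21** — this file supplies the characteristic functions themselves,
as real-valued functions on the concrete field spaces, identifies `χ = 1` with r12's restriction, and instantiates p14's
(3.38) ⇒ (3.51) (`B1Ineq351Proof.ineq351`) with them.

WHAT IS PRINTED (verbatim).  p. 614 [PDF 12]: *"We estimate the integral (3.7) from below by the same integral with
additional characteristic functions χ(A′) = Π_{x∈T₁} χ({|A′(x)| ≦ p₁(ε)}), p₁(ε) = b₁(1 + log ε⁻¹)^{p₁}. (3.12)"*.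
p. 615 [PDF 13]: *"Again we introduce restrictions on the fields φ′ and we estimate the integral from below inserting the
characteristic functions χ(φ′) = Π_{x∈T₁} χ({|φ′(x)| ≦ p₁(ε)}). (3.20)"*.  p. 619 [PDF 17]: *"We estimate the integral
(3.38) from below introducing the characteristic functions χ(A′) = Π_{x∈T₁^{(k)}} χ({|A′(x)| ≦ p₁(L^kε)}), (3.43)"*.
p. 621 [PDF 19]: *"Finally we estimate from below the integral introducing the characteristic functions χ(φ′) =
Π_{x∈T₁^{(k)}} χ({|φ′(x)| ≦ p₁(L^kε)}). (3.50)"*, after which (3.51) displays the lower bound with the factor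
`χ(A′)χ(φ′)` under the fluctuation integral.

WHAT THIS FILE PROVIDES (0 `sorry`, 0 `Prop`-valued definitions; standard axioms).
§1 `chiFluct t |F|` = `Π_x χ({|F(x)| ≦ t})` — the common printed shape, a product of the typer's indicators
   `B1Eq31Concrete.ind` over the sites; `chiFluct_eq_ite`, values in `[0,1]`, **`chiFluct_eq_one_iff`: `χ = 1 ↔` r12's
   restriction `B1Sect3Statements.SmallFluct t |F|`** (the decl of record), measurability in a parameter.
§2 ON THE CARRIER (`HiggsLattice`): **`chiFluctA t A′`** = (3.12)/(3.43) for a vector field `A′` on a lattice `T^{(k)}` of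
   the family, `|A′(x)|` = the Euclidean norm of `(A′_μ(x))_μ ∈ ℝ^d` (I p. 608, the typer's `toSite`, as in the typer's
   `chi0A`); **`chiFluctφ t φ′`** = (3.20)/(3.50) for an `ℝ^N`-valued site function; the threshold `t` is a parameter —
   print's instances `t = p₁(ε)` ((3.12)/(3.20), `T₁`) and `t = p₁(L^kε)` ((3.43)/(3.50), `T₁^{(k)}`) with
   `p₁(s) = b₁(1 + log s⁻¹)^{p₁}` (`B2.pFn b₁ p₁ s`) are written out letter for letter (`chiFluctA_printed`,
   `chiFluctφ_printed`); in `ε`-units one takes `t = s^{−(d−2)/2}p₁(s)` (`B1Eq31Concrete.thrF`, cf. `B1Eq353SupNorm`),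
   which is `p₁(s)` itself on the unit lattice (`thrF_one`).  API: `_mem_Icc`, `_nonneg`, `_le_one`, `_eq_one_iff`
   (`↔ SmallFluct`), `measurable_chiFluctA`, `measurable_chiFluctφ`.
§3 CONSUMED WHERE PRINT USES THEM — *"we estimate the integral from below introducing the characteristic functions"*:
   `integral_insert_chiFluctA_le`, `integral_insert_chiFluctφ_le` (inserting `χ(A′)` resp. `χ(φ′)` against a non-negative
   integrable integrand can only decrease the integral — p14's `integral_insert_cutoff_le` with its `0 ≤ χ ≤ 1` hypotheses
   DISCHARGED), and **`ineq351_chiFluct`**: p14's (3.38) ⇒ (3.51) `B1Ineq351Proof.ineq351` on the concrete field spaces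
   `A′ ∈ VecField`, `φ′ ∈ ScalarField` with `χ(A′) := chiFluctA t_A`, `χ(φ′) := chiFluctφ t_φ` (the four `χ`-hypotheses
   discharged; the two splitting hypotheses (3.41)/(3.48), `K ≥ 0`, `G ≥ 0` and integrability as in p14's theorem).
§4 **`split311_transl348`**: the scalar splitting hypothesis of `ineq351` IS r14's `B1Sect3FormsConcrete.form348_split`
   ((3.48) ⇒ the sentence after it, on the carrier: `Split311 (a(L^{k+1}ε)^{−2}) C^{(k)}(B) Q*(B) [½·joint form] [½⟨ψ,Δ^{(k+1)}(B)ψ⟩]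
   [½⟨φ′,C^{(k)}(B)^{−1}φ′⟩]`, `k < K`, `m² > 0`, `a > 0`, `L > 1`), and **`ineq351_transl348`**: (3.38) ⇒ (3.51) with the
   scalar translation (3.48) AND `χ(A′)`, `χ(φ′)` concrete — only the vector-field split (3.41) (p14's `hA`; its concrete
   instance is the case `N = d`, trivial coupling, zero background of `split311_transl348` read through `toSite`, not
   packaged here), `K ≥ 0`, `G ≥ 0` and the integrability of the translated integrands remain hypotheses.
HONEST SCOPE.  (a) The thresholds are parameters (print: `p₁(ε)`, `p₁(L^kε)`; the conditions (3.13)/(3.21)/(3.54) relating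
`p₁` to `p` are r12's rows B1.Eq3.13 / 3.20-3.21 / 3.54, p04's `B1Ineq354Proof`, untouched); (b) nothing quantitative beyond
`0 ≤ χ ≤ 1`: the consequences print draws from the restrictions ((3.52)–(3.55), `B1Eq353SupNorm`, `B1Ineq353Proof`) are
not re-derived; (c) the measures `dA′`, `dφ′` in §3–§4 are arbitrary translation-invariant measures on the field spaces, as
in p14's theorem (print: Lebesgue).
-/

open scoped BigOperators InnerProductSpace
open _root_.MeasureTheory

namespace Literature.MathematicalPhysics.QuantumFieldTheory.Balaban1983to89.B1Eq343FluctuationChi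

open HiggsLattice HiggsAveraging HiggsCovariance
open B1Eq31Concrete (ind ind_eq_one_iff ind_mem_Icc thrF thrF_one continuous_toSite)
open B3MultiscaleFields (toSite)
open B1Sect3Statements (SmallFluct Split311 transl310)
open B1Ineq351Proof (integral_insert_cutoff_le ineq351)
-- the §4 vocabulary (all imported through `B1Sect3FormsConcrete`)
open B1Eq27StepAdjoint B1Eq230FluctCov B2Eq227CondDelta B1Eq218Model
open B1Eq221GaussStep (jointExp)
open B1Sect3FormsConcrete (transl348 transl348_eq_transl310 form348_split)

noncomputable section

/-! ## §1 The printed shape `Π_x χ({|F(x)| ≦ t})` -/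

section Generic

variable {X : Type} [Fintype X]

/-- `Π_{x} χ({|F(x)| ≦ t})` for a size function `x ↦ |F(x)|` (`absF`) on a finite set of sites and one threshold `t` —
the common shape of (3.12), (3.20), (3.43), (3.50); each factor is the typer's indicator `B1Eq31Concrete.ind`.
[cite: Balaban1982Higgs1, (3.43) p.619] -/
def chiFluct (t : ℝ) (absF : X → ℝ) : ℝ :=
  ∏ x, ind (absF x) t

/-- Unfolding. [cite: Balaban1982Higgs1, (3.43) p.619] -/
theorem chiFluct_def (t : ℝ) (absF : X → ℝ) : chiFluct t absF = ∏ x, ind (absF x) t := rfl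

/-- The product of indicators is the indicator of *"the restriction holds at every site"*. [cite: Balaban1982Higgs1, (3.43) p.619] -/
theorem chiFluct_eq_ite (t : ℝ) (absF : X → ℝ) :
    chiFluct t absF = if ∀ x, absF x ≤ t then 1 else 0 := by
  unfold chiFluct ind
  rw [Finset.prod_boole]
  simp

/-- `0 ≤ χ ≤ 1`. [cite: Balaban1982Higgs1, (3.43) p.619] -/
theorem chiFluct_mem_Icc (t : ℝ) (absF : X → ℝ) : chiFluct t absF ∈ Set.Icc (0 : ℝ) 1 := by
  rw [chiFluct_eq_ite]
  split_ifs <;> simp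

/-- `0 ≤ χ`. [cite: Balaban1982Higgs1, (3.43) p.619] -/
theorem chiFluct_nonneg (t : ℝ) (absF : X → ℝ) : 0 ≤ chiFluct t absF := (chiFluct_mem_Icc t absF).1

/-- `χ ≤ 1`. [cite: Balaban1982Higgs1, (3.43) p.619] -/
theorem chiFluct_le_one (t : ℝ) (absF : X → ℝ) : chiFluct t absF ≤ 1 := (chiFluct_mem_Icc t absF).2

/-- **`χ = 1` iff r12's restriction holds**: `Π_x χ({|F(x)| ≦ t}) = 1 ↔ B1Sect3Statements.SmallFluct t |F|`
(`∀ x, |F(x)| ≦ t`, the decl of record of rows B1.Eq3.12/3.43/3.50). [cite: Balaban1982Higgs1, (3.43) p.619] -/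
theorem chiFluct_eq_one_iff (t : ℝ) (absF : X → ℝ) : chiFluct t absF = 1 ↔ SmallFluct t absF := by
  rw [chiFluct_eq_ite, SmallFluct]
  split_ifs with h
  · simp [h]
  · simp [h]

/-- `χ = 0` iff the restriction fails somewhere. [cite: Balaban1982Higgs1, (3.43) p.619] -/
theorem chiFluct_eq_zero_iff (t : ℝ) (absF : X → ℝ) : chiFluct t absF = 0 ↔ ¬ SmallFluct t absF := by
  rw [chiFluct_eq_ite, SmallFluct]
  split_ifs with h
  · simp [h]
  · simp [h]

/-- Measurability of `χ` in any parameter on which the size function depends measurably. [cite: Balaban1982Higgs1, (3.43) p.619] -/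
theorem measurable_chiFluct {Ω : Type*} [MeasurableSpace Ω] (t : ℝ) {F : Ω → X → ℝ}
    (hF : ∀ x, Measurable fun ω => F ω x) : Measurable fun ω => chiFluct t (F ω) := by
  unfold chiFluct ind
  refine Finset.measurable_prod _ fun x _ => ?_
  exact Measurable.ite (measurableSet_le (hF x) measurable_const) measurable_const measurable_const

end Generic

/-! ## §2 On the carrier: `χ(A′)` (3.12)/(3.43) and `χ(φ′)` (3.20)/(3.50) -/

section Carrier

variable {P : HiggsLattice.Params} {k N : ℕ}

/-- **(3.12) p. 614 / (3.43) p. 619**, verbatim (3.43): *"χ(A′) = Π_{x∈T₁^{(k)}} χ({|A′(x)| ≦ p₁(L^kε)})"* — for a vector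
field `A′` on the lattice `T^{(k)}` of the family, `|A′(x)|` the Euclidean norm of `(A′_μ(x))_μ ∈ ℝ^d` (I p. 608; the
typer's `toSite`), threshold `t` (print: `p₁(ε)` on `T₁` in (3.12), `p₁(L^kε)` on `T₁^{(k)}` in (3.43); in `ε`-units
`t = (L^kε)^{−(d−2)/2}p₁(L^kε)` = `B1Eq31Concrete.thrF d (L^kε) (p₁(L^kε))`). [cite: Balaban1982Higgs1, (3.43) p.619] -/
def chiFluctA (t : ℝ) (A' : HiggsLattice.VecField P k) : ℝ :=
  chiFluct t fun x => ‖toSite A' x‖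

/-- **(3.20) p. 615 / (3.50) p. 621**, verbatim (3.50): *"χ(φ′) = Π_{x∈T₁^{(k)}} χ({|φ′(x)| ≦ p₁(L^kε)})"* — for an
`ℝ^N`-valued site function `φ′` on `T^{(k)}`, threshold `t` as in `chiFluctA`. [cite: Balaban1982Higgs1, (3.50) p.621] -/
def chiFluctφ (t : ℝ) (φ' : HiggsLattice.ScalarField P k N) : ℝ :=
  chiFluct t fun x => ‖φ' x‖

/-- (3.12)/(3.43) with the printed threshold written out: `p₁(s) = b₁(1 + log s⁻¹)^{p₁}` (`B2.pFn b₁ p₁ s`; print: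
`s = ε` in (3.12), `s = L^kε` in (3.43)). [cite: Balaban1982Higgs1, (3.12) p.614] -/
theorem chiFluctA_printed (b₁ p₁ s : ℝ) (A' : HiggsLattice.VecField P k) :
    chiFluctA (B2.pFn b₁ p₁ s) A' = ∏ x : HiggsLattice.Site P k, ind ‖toSite A' x‖ (b₁ * (1 + Real.log s⁻¹) ^ p₁) := by
  simp only [chiFluctA, chiFluct_def, B2.pFn]

/-- (3.20)/(3.50) with the printed threshold written out. [cite: Balaban1982Higgs1, (3.50) p.621] -/
theorem chiFluctφ_printed (b₁ p₁ s : ℝ) (φ' : HiggsLattice.ScalarField P k N) :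
    chiFluctφ (B2.pFn b₁ p₁ s) φ' = ∏ x : HiggsLattice.Site P k, ind ‖φ' x‖ (b₁ * (1 + Real.log s⁻¹) ^ p₁) := by
  simp only [chiFluctφ, chiFluct_def, B2.pFn]

/-- The two-scale threshold on the unit lattice is the printed one: `1^{−(d−2)/2}·p₁ = p₁`. [cite: Balaban1982Higgs1, (3.43) p.619] -/
theorem chiFluctA_thrF_one (d : ℕ) (p1 : ℝ) (A' : HiggsLattice.VecField P k) :
    chiFluctA (thrF d 1 p1) A' = chiFluctA p1 A' := by
  rw [thrF_one]

/-- The same for `χ(φ′)`. [cite: Balaban1982Higgs1, (3.50) p.621] -/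
theorem chiFluctφ_thrF_one (d : ℕ) (p1 : ℝ) (φ' : HiggsLattice.ScalarField P k N) :
    chiFluctφ (thrF d 1 p1) φ' = chiFluctφ p1 φ' := by
  rw [thrF_one]

/-- `0 ≤ χ(A′) ≤ 1`. [cite: Balaban1982Higgs1, (3.43) p.619] -/
theorem chiFluctA_mem_Icc (t : ℝ) (A' : HiggsLattice.VecField P k) : chiFluctA t A' ∈ Set.Icc (0 : ℝ) 1 :=
  chiFluct_mem_Icc _ _

/-- `0 ≤ χ(A′)`. [cite: Balaban1982Higgs1, (3.43) p.619] -/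
theorem chiFluctA_nonneg (t : ℝ) (A' : HiggsLattice.VecField P k) : 0 ≤ chiFluctA t A' := chiFluct_nonneg _ _

/-- `χ(A′) ≤ 1`. [cite: Balaban1982Higgs1, (3.43) p.619] -/
theorem chiFluctA_le_one (t : ℝ) (A' : HiggsLattice.VecField P k) : chiFluctA t A' ≤ 1 := chiFluct_le_one _ _

/-- `0 ≤ χ(φ′) ≤ 1`. [cite: Balaban1982Higgs1, (3.50) p.621] -/
theorem chiFluctφ_mem_Icc (t : ℝ) (φ' : HiggsLattice.ScalarField P k N) : chiFluctφ t φ' ∈ Set.Icc (0 : ℝ) 1 :=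
  chiFluct_mem_Icc _ _

/-- `0 ≤ χ(φ′)`. [cite: Balaban1982Higgs1, (3.50) p.621] -/
theorem chiFluctφ_nonneg (t : ℝ) (φ' : HiggsLattice.ScalarField P k N) : 0 ≤ chiFluctφ t φ' := chiFluct_nonneg _ _

/-- `χ(φ′) ≤ 1`. [cite: Balaban1982Higgs1, (3.50) p.621] -/
theorem chiFluctφ_le_one (t : ℝ) (φ' : HiggsLattice.ScalarField P k N) : chiFluctφ t φ' ≤ 1 := chiFluct_le_one _ _

/-- **`χ(A′) = 1 ↔` r12's restriction `SmallFluct t (x ↦ |A′(x)|)`** (`∀ x, |A′(x)| ≦ t`). [cite: Balaban1982Higgs1, (3.43) p.619] -/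
theorem chiFluctA_eq_one_iff (t : ℝ) (A' : HiggsLattice.VecField P k) :
    chiFluctA t A' = 1 ↔ SmallFluct t fun x => ‖toSite A' x‖ :=
  chiFluct_eq_one_iff _ _

/-- **`χ(φ′) = 1 ↔` r12's restriction `SmallFluct t (x ↦ |φ′(x)|)`** — the form in which (3.52)–(3.53) and p. 621
*"From (3.50) it follows that …"* (`B1Eq353SupNorm`) consume (3.50). [cite: Balaban1982Higgs1, (3.50) p.621] -/
theorem chiFluctφ_eq_one_iff (t : ℝ) (φ' : HiggsLattice.ScalarField P k N) :
    chiFluctφ t φ' = 1 ↔ SmallFluct t fun x => ‖φ' x‖ :=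
  chiFluct_eq_one_iff _ _

/-- Under `χ(φ′) = 1` every site value is bounded by the threshold (the pointwise form used on p. 621).
[cite: Balaban1982Higgs1, (3.50) p.621] -/
theorem norm_le_of_chiFluctφ_eq_one {t : ℝ} {φ' : HiggsLattice.ScalarField P k N} (h : chiFluctφ t φ' = 1) (x : HiggsLattice.Site P k) :
    ‖φ' x‖ ≤ t :=
  (chiFluctφ_eq_one_iff t φ').1 h x

/-- Under `χ(A′) = 1` every site value is bounded by the threshold. [cite: Balaban1982Higgs1, (3.43) p.619] -/
theorem norm_le_of_chiFluctA_eq_one {t : ℝ} {A' : HiggsLattice.VecField P k} (h : chiFluctA t A' = 1) (x : HiggsLattice.Site P k) :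
    ‖toSite A' x‖ ≤ t :=
  (chiFluctA_eq_one_iff t A').1 h x

/-- `χ(A′)` is measurable in `A′`. [cite: Balaban1982Higgs1, (3.43) p.619] -/
theorem measurable_chiFluctA (t : ℝ) : Measurable (chiFluctA t : HiggsLattice.VecField P k → ℝ) := by
  unfold chiFluctA
  exact measurable_chiFluct t fun x => (((continuous_apply x).comp continuous_toSite).norm).measurable

/-- `χ(φ′)` is measurable in `φ′`. [cite: Balaban1982Higgs1, (3.50) p.621] -/
theorem measurable_chiFluctφ (t : ℝ) : Measurable (chiFluctφ t : HiggsLattice.ScalarField P k N → ℝ) := by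
  unfold chiFluctφ
  exact measurable_chiFluct t fun x => ((continuous_apply x).norm).measurable

end Carrier

/-! ## §3 The printed use: inserting `χ(A′)`, `χ(φ′)` estimates the integral from below; p14's (3.38) ⇒ (3.51) with them -/

section Use

variable {P : HiggsLattice.Params} {k N : ℕ}

/-- p. 619 / p. 621: *"we estimate the integral from below introducing the characteristic functions"* — for `χ(A′)`:
`∫ χ(A′)·f(A′) dA′ ≦ ∫ f(A′) dA′` for every non-negative integrable `f` and every measure `dA′` on the vector fields
(p14's `integral_insert_cutoff_le`, its hypotheses `0 ≤ χ ≤ 1` discharged). [cite: Balaban1982Higgs1, (3.43) p.619] -/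
theorem integral_insert_chiFluctA_le (μ : Measure (HiggsLattice.VecField P k)) (t : ℝ) {f : HiggsLattice.VecField P k → ℝ} (hf : Integrable f μ)
    (hf0 : ∀ A', 0 ≤ f A') : ∫ A', chiFluctA t A' * f A' ∂μ ≤ ∫ A', f A' ∂μ :=
  integral_insert_cutoff_le μ hf hf0 (chiFluctA_nonneg t) (chiFluctA_le_one t)

/-- The same for `χ(φ′)` on the scalar fields. [cite: Balaban1982Higgs1, (3.50) p.621] -/
theorem integral_insert_chiFluctφ_le (ν : Measure (HiggsLattice.ScalarField P k N)) (t : ℝ) {f : HiggsLattice.ScalarField P k N → ℝ}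
    (hf : Integrable f ν) (hf0 : ∀ φ', 0 ≤ f φ') : ∫ φ', chiFluctφ t φ' * f φ' ∂ν ≤ ∫ φ', f φ' ∂ν :=
  integral_insert_cutoff_le ν hf hf0 (chiFluctφ_nonneg t) (chiFluctφ_le_one t)

/-- **(3.38) ⇒ (3.51) p. 621 with print's `χ(A′)`, `χ(φ′)`**: p14's `B1Ineq351Proof.ineq351` on the concrete field spaces
(`A, A′ ∈ VecField P k`, `B ∈ VecField P (k+1)`, `φ, φ′ ∈ ScalarField P k N`, `ψ ∈ ScalarField P (k+1) N`) with
`χ(A′) := chiFluctA t_A`, `χ(φ′) := chiFluctφ t_φ`: `K·e^{−qB(B)}e^{−qψ(ψ)}·∫dA′ χ(A′)e^{−qA′(A′)}∫dφ′ χ(φ′)e^{−qφ′(φ′)}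
G(A′ + c_AC_AQ*_AB, φ′ + c_φC_φQ*_φψ) ≦ K·∫dA e^{−qAB(A,B)}∫dφ e^{−qφψ(φ,ψ)}G(A,φ)` — the two splitting hypotheses
((3.41)→ the sentence after it, (3.48) → the sentence after it), `K ≥ 0`, `G ≥ 0` and integrability as in p14's theorem;
the four `χ`-hypotheses DISCHARGED. [cite: Balaban1982Higgs1, (3.51) p.621] -/
theorem ineq351_chiFluct (μ : Measure (HiggsLattice.VecField P k)) [μ.IsAddLeftInvariant] (ν : Measure (HiggsLattice.ScalarField P k N))
    [ν.IsAddLeftInvariant] {cA : ℝ} {CA : HiggsLattice.VecField P k →ₗ[ℝ] HiggsLattice.VecField P k} {QsA : HiggsLattice.VecField P (k + 1) →ₗ[ℝ] HiggsLattice.VecField P k}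
    {qAB : HiggsLattice.VecField P k → HiggsLattice.VecField P (k + 1) → ℝ} {qB : HiggsLattice.VecField P (k + 1) → ℝ} {qA' : HiggsLattice.VecField P k → ℝ}
    (hA : Split311 cA CA QsA qAB qB qA') {cφ : ℝ} {Cφ : HiggsLattice.ScalarField P k N →ₗ[ℝ] HiggsLattice.ScalarField P k N}
    {Qsφ : HiggsLattice.ScalarField P (k + 1) N →ₗ[ℝ] HiggsLattice.ScalarField P k N} {qφψ : HiggsLattice.ScalarField P k N → HiggsLattice.ScalarField P (k + 1) N → ℝ}
    {qψ : HiggsLattice.ScalarField P (k + 1) N → ℝ} {qφ' : HiggsLattice.ScalarField P k N → ℝ} (hφ : Split311 cφ Cφ Qsφ qφψ qψ qφ')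
    (B : HiggsLattice.VecField P (k + 1)) (ψ : HiggsLattice.ScalarField P (k + 1) N) {K : ℝ} (hK : 0 ≤ K)
    {G : HiggsLattice.VecField P k → HiggsLattice.ScalarField P k N → ℝ} (hG : ∀ A φ, 0 ≤ G A φ) (tA tφ : ℝ)
    (hintφ : ∀ A', Integrable (fun φ' => Real.exp (-qφ' φ')
      * G (transl310 cA CA QsA A' B) (transl310 cφ Cφ Qsφ φ' ψ)) ν)
    (hintA : Integrable (fun A' => Real.exp (-qA' A') * ∫ φ', Real.exp (-qφ' φ')
      * G (transl310 cA CA QsA A' B) (transl310 cφ Cφ Qsφ φ' ψ) ∂ν) μ) :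
    K * (Real.exp (-qB B) * Real.exp (-qψ ψ) *
        ∫ A', chiFluctA tA A' * (Real.exp (-qA' A') * ∫ φ', chiFluctφ tφ φ' * (Real.exp (-qφ' φ')
          * G (transl310 cA CA QsA A' B) (transl310 cφ Cφ Qsφ φ' ψ)) ∂ν) ∂μ)
      ≤ K * ∫ A, Real.exp (-qAB A B) * ∫ φ, Real.exp (-qφψ φ ψ) * G A φ ∂ν ∂μ :=
  ineq351 μ ν hA hφ B ψ hK hG (chiFluctA_nonneg tA) (chiFluctA_le_one tA) (chiFluctφ_nonneg tφ)
    (chiFluctφ_le_one tφ) hintφ hintA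

end Use

/-! ## §4 The scalar splitting hypothesis IS (3.48) on the carrier (`B1Sect3FormsConcrete.form348_split`) -/

section Scalar348

variable {P : HiggsLattice.Params} {N : ℕ} (C : ChargeData N) (Ω : Finset (HiggsLattice.Site P 0))

/-- **The sentence after (3.48) p. 621 in p14's `Split311` form**: with `c = a(L^{k+1}ε)^{−2}` (`stepCoef`), `C = C^{(k)}(Ω,B)`
(p35's `fluctCovA`), `Q* = Q*(B)` (`avgQAdjLin`) — so that p14's `transl310 c C Q* φ′ ψ` IS r14's `transl348 φ′ ψ`
(`B1Sect3FormsConcrete.transl348_eq_transl310`) —, the joint form `qφψ(φ, ψ) = ½[a(L^{k+1}ε)^{d−2}Σ_y‖ψ(y) − (Q(B)φ)(y)‖² +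
⟨φ, Δ^{(k)}(Ω,B)φ⟩]`, `qψ(ψ) = ½⟨ψ, Δ^{(k+1)}(Ω,B)ψ⟩` and `qφ′(φ′) = ½⟨φ′, C^{(k)}(Ω,B)^{−1}φ′⟩` SPLIT:
`qφψ(φ′ + cCQ*ψ, ψ) = qψ(ψ) + qφ′(φ′)` (`k < K`; `m² > 0`, `a > 0`, `L > 1`).  PROVED: `form348_split`.
[cite: Balaban1982Higgs1, (3.48) p.621] -/
theorem split311_transl348 {msq a : ℝ} (hmsq : 0 < msq) (ha : 0 < a) (hL : 1 < (P.L : ℝ)) {k : ℕ} (hk : k < P.K)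
    (B : HiggsLattice.VecField P 0) :
    Split311 (stepCoef P a k) (fluctCovA C Ω B msq a k : Module.End ℝ (HiggsLattice.ScalarField P k N)) (avgQAdjLin C B k)
      (fun φ ψ => 1 / 2 * jointExp (B1RT.prec a (P.mesh (k + 1)) P.d) (avgQLin C B k) (deltaForm C Ω B msq a k) ψ φ)
      (fun ψ => 1 / 2 * siteInner ψ (deltaKA C Ω B msq a (k + 1) ψ))
      (fun φ' => 1 / 2 * siteInner φ' (precOpA C Ω B msq a k φ')) := by
  intro φ' ψ
  simp only
  rw [← transl348_eq_transl310, form348_split C Ω hmsq ha hL hk B ψ φ', add_comm]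

/-- **(3.38) ⇒ (3.51) with the scalar translation (3.48) and print's `χ(A′)`, `χ(φ′)` CONCRETE**: `ineq351_chiFluct` with
its scalar splitting hypothesis discharged by `split311_transl348` — the new scalar integration variable is `φ′` with
`φ = φ′ + a(L^{k+1}ε)^{−2}C^{(k)}(Ω,B)Q*(B)ψ` (`transl348`), the block-field factor is `e^{−½⟨ψ,Δ^{(k+1)}(Ω,B)ψ⟩}` and the
fluctuation weight `e^{−½⟨φ′,C^{(k)}(Ω,B)^{−1}φ′⟩}`; the vector-field split (3.41) stays p14's hypothesis `hA` (abstract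
`c_A, C_A, Q*_A` and forms), as do `K ≥ 0`, `G ≥ 0`, integrability. [cite: Balaban1982Higgs1, (3.51) p.621] -/
theorem ineq351_transl348 {msq a : ℝ} (hmsq : 0 < msq) (ha : 0 < a) (hL : 1 < (P.L : ℝ)) {k : ℕ} (hk : k < P.K)
    (Bbg : HiggsLattice.VecField P 0) (μ : Measure (HiggsLattice.VecField P k)) [μ.IsAddLeftInvariant]
    (ν : Measure (HiggsLattice.ScalarField P k N)) [ν.IsAddLeftInvariant] {cA : ℝ} {CA : HiggsLattice.VecField P k →ₗ[ℝ] HiggsLattice.VecField P k}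
    {QsA : HiggsLattice.VecField P (k + 1) →ₗ[ℝ] HiggsLattice.VecField P k} {qAB : HiggsLattice.VecField P k → HiggsLattice.VecField P (k + 1) → ℝ}
    {qB : HiggsLattice.VecField P (k + 1) → ℝ} {qA' : HiggsLattice.VecField P k → ℝ} (hA : Split311 cA CA QsA qAB qB qA')
    (B : HiggsLattice.VecField P (k + 1)) (ψ : HiggsLattice.ScalarField P (k + 1) N) {K : ℝ} (hK : 0 ≤ K)
    {G : HiggsLattice.VecField P k → HiggsLattice.ScalarField P k N → ℝ} (hG : ∀ A φ, 0 ≤ G A φ) (tA tφ : ℝ)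
    (hintφ : ∀ A', Integrable (fun φ' => Real.exp (-(1 / 2 * siteInner φ' (precOpA C Ω Bbg msq a k φ')))
      * G (transl310 cA CA QsA A' B) (transl348 C Ω msq a k Bbg φ' ψ)) ν)
    (hintA : Integrable (fun A' => Real.exp (-qA' A') * ∫ φ', Real.exp (-(1 / 2 * siteInner φ' (precOpA C Ω Bbg msq a k φ')))
      * G (transl310 cA CA QsA A' B) (transl348 C Ω msq a k Bbg φ' ψ) ∂ν) μ) :
    K * (Real.exp (-qB B) * Real.exp (-(1 / 2 * siteInner ψ (deltaKA C Ω Bbg msq a (k + 1) ψ))) *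
        ∫ A', chiFluctA tA A' * (Real.exp (-qA' A') * ∫ φ', chiFluctφ tφ φ'
          * (Real.exp (-(1 / 2 * siteInner φ' (precOpA C Ω Bbg msq a k φ')))
            * G (transl310 cA CA QsA A' B) (transl348 C Ω msq a k Bbg φ' ψ)) ∂ν) ∂μ)
      ≤ K * ∫ A, Real.exp (-qAB A B) * ∫ φ,
          Real.exp (-(1 / 2 * jointExp (B1RT.prec a (P.mesh (k + 1)) P.d) (avgQLin C Bbg k) (deltaForm C Ω Bbg msq a k) ψ φ))
            * G A φ ∂ν ∂μ := by
  have h := ineq351_chiFluct μ ν hA (split311_transl348 C Ω hmsq ha hL hk Bbg) B ψ hK hG tA tφ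
    (by simpa only [transl348_eq_transl310] using hintφ) (by simpa only [transl348_eq_transl310] using hintA)
  simpa only [transl348_eq_transl310] using h

end Scalar348

end

end Literature.MathematicalPhysics.QuantumFieldTheory.Balaban1983to89.B1Eq343FluctuationChi
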